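import Summits.QuantumAdvantage.AdviceFreeQNC0.AffBells26FlipCubeSieve
import Literature.Probability.LatticeModels.HardCorePairsAtDistanceTwo
import HarnessLib

/-!
# W-38 glue, typed (qn-lit g29; sketch, ns `AffBells29lit`): the `pairs2`-parity of the kernel line is unbiased

S2 of qn-p1 g29's v7 programme.  Three steps, all PROVED:

1. `sum_odd_kline_eq` — the EXACT law of the kernel line (pushforward of the odd class under `x ↦ J(x)`):
   `Σ_{x odd} s(J(x)) = Σ_{v hard-core, Z(v) ≥ 1} 2^{Z(v)−1} s(v) + [N odd]·s(1…1)` for every statistic `s`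
   (`Fib19.card_fibre`, `Fib19.kline_hardCore`; the all-ones line occurs once, at `x = 0`, iff `N` is odd).
2. `hardCoreSum_eq_cycSum` — the fugacity-2 signed sum `Σ_{v hard-core} 2^{Z(v)} (−1)^{pairs2 v}` on `Fin (j+2)` IS the
   Literature quantity `HardCorePairs2.cycSum j` (`Literature/Probability/LatticeModels/HardCorePairsAtDistanceTwo.lean`, p660273):
   the `j+2` ordered pairs `(i, i+2)` of `AffBells26.pairs2` are exactly the sign factors of `HardCorePairs2.cycWt`.
3. `abs_card_pairs2_even_sub_le` — with `HardCorePairs2.abs_cycSum_le'` (`|cycSum j| ≤ 1024·(7/4)^j`):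
   `|#{x odd : pairs2 (J x) even} − 2^j| ≤ (1024·(7/4)^j + 3)/4` on `N = j + 2 ≥ 3` positions, i.e. the parity of `pairs2 (J x)` has
   bias `≤ 2^7·(7/8)^j + 2^{-j}` under the uniform odd input.  With `rel_iff_pairs2_even` (g29/AffBells29Pure.lean): every CLASS-PURE
   far-from-frame strategy wins `½ ± (2^7 (7/8)^{N−2} + 2^{2−N})` of the odd inputs.
-/

namespace Summit.QuantumAdvantage.AdviceFreeQNC0

namespace AffBells29lit

open Finset Literature.Computability.QuantumComplexity Literature.Computability.QuantumComplexity.RingHLF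
open AffBells23 AffBells26 Fib19
open Literature.Probability.LatticeModels

variable {N : ℕ}

/-! ## 1. The exact law of the kernel line -/

/-- The all-ones vector is not the zero vector (`N ≥ 1`). -/
theorem allOnes_ne_zero (hN : 1 ≤ N) : (fun _ : Fin N => true) ≠ fun _ => false := by
  intro h
  have h0 := congr_fun h ⟨0, hN⟩
  simp at h0

/-- For an odd pattern, the kernel line is all-ones iff the pattern is zero (forcing equations `x_b = 1 ⊕ 1`). -/
theorem kline_eq_allOnes_iff (hN : 3 ≤ N) (x : Fin N → Bool) (hx : IsOdd x) :
    kline x = (fun _ => true) ↔ x = fun _ => false := by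
  rw [kline_eq_iff_inKernel hN x hx (allOnes_ne_zero (by omega)),
    inKernel_iff_forced (fun _ => true) (fun i h => by simp at h) x]
  constructor
  · intro h
    funext b
    have hb := h b rfl
    simpa using hb
  · rintro rfl b _
    simp

/-- The zero pattern has `N` zeros. -/
theorem zeros_allZero : zeros (fun _ : Fin N => false) = N := by
  simp [zeros]

/-- The zero pattern is odd iff `N` is odd. -/
theorem isOdd_allZero_iff : IsOdd (fun _ : Fin N => false) ↔ N % 2 = 1 := by
  rw [isOdd_iff, zeros_allZero]

/-- The all-ones vector has no zeros. -/
theorem zeros_allOnes : zeros (fun _ : Fin N => true) = 0 := by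
  simp [zeros]

/-- A vector without zeros is all-ones. -/
theorem eq_allOnes_of_zeros_eq_zero (v : Fin N → Bool) (h : zeros v = 0) : v = fun _ => true := by
  funext i
  by_contra hi
  have hmem : i ∈ univ.filter (fun i : Fin N => v i = false) := by
    rw [mem_filter]; exact ⟨mem_univ _, by simpa using hi⟩
  unfold zeros at h
  rw [Finset.card_eq_zero] at h
  rw [h] at hmem
  simp at hmem

/-- The all-ones vector is hard-core (`N ≥ 1`). -/
theorem hardCore_allOnes (hN : 1 ≤ N) : HardCore (fun _ : Fin N => true) :=
  ⟨fun i h => by simp at h, ⟨⟨0, hN⟩, rfl⟩⟩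

/-- The fibre of the all-ones line inside the odd class: `{0}` if `N` is odd, empty otherwise. -/
theorem card_fibre_allOnes (hN : 3 ≤ N) :
    (univ.filter fun x : Fin N → Bool => IsOdd x ∧ kline x = fun _ => true).card = if N % 2 = 1 then 1 else 0 := by
  by_cases hodd : N % 2 = 1
  · rw [if_pos hodd]
    have hset : (univ.filter fun x : Fin N → Bool => IsOdd x ∧ kline x = fun _ => true) = {fun _ => false} := by
      ext x
      rw [mem_filter, mem_singleton]
      constructor
      · rintro ⟨-, hx, hk⟩
        exact (kline_eq_allOnes_iff hN x hx).1 hk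
      · rintro rfl
        have ho : IsOdd (fun _ : Fin N => false) := isOdd_allZero_iff.2 hodd
        exact ⟨mem_univ _, ho, (kline_eq_allOnes_iff hN _ ho).2 rfl⟩
    rw [hset, card_singleton]
  · rw [if_neg hodd, Finset.card_eq_zero]
    ext x
    simp only [mem_filter, mem_univ, true_and, Finset.notMem_empty, iff_false, not_and]
    intro hx hk
    have hx0 := (kline_eq_allOnes_iff hN x hx).1 hk
    subst hx0
    exact hodd (isOdd_allZero_iff.1 hx)

open scoped Classical in
/-- **The exact law of the kernel line.**  For every statistic `s`,
`Σ_{x odd} s(J(x)) = Σ_{v hard-core, Z(v) ≥ 1} 2^{Z(v)−1}·s(v) + [N odd]·s(1…1)` (`card_fibre`; the all-ones line has the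
single preimage `x = 0`, which is odd iff `N` is odd). -/
theorem sum_odd_kline_eq (hN : 3 ≤ N) (s : (Fin N → Bool) → ℝ) :
    ∑ x ∈ (univ.filter fun x : Fin N → Bool => IsOdd x), s (kline x)
      = ∑ v ∈ (univ.filter fun v : Fin N → Bool => HardCore v ∧ 0 < zeros v), (2 : ℝ) ^ (zeros v - 1) * s v
        + (if N % 2 = 1 then s (fun _ => true) else 0) := by
  have hmaps : ∀ x ∈ (univ.filter fun x : Fin N → Bool => IsOdd x),
      kline x ∈ (univ.filter fun v : Fin N → Bool => HardCore v) := by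
    intro x hx
    rw [mem_filter] at hx ⊢
    exact ⟨mem_univ _, kline_hardCore hN x hx.2⟩
  rw [← sum_fiberwise_of_maps_to hmaps]
  have hfib : ∀ v : Fin N → Bool,
      ∑ x ∈ (univ.filter fun x : Fin N → Bool => IsOdd x).filter (fun x => kline x = v), s (kline x)
        = ((univ.filter fun x : Fin N → Bool => IsOdd x ∧ kline x = v).card : ℝ) * s v := by
    intro v
    rw [Finset.filter_filter, sum_congr rfl fun x hx => by rw [(mem_filter.mp hx).2.2], sum_const, nsmul_eq_mul]
  rw [sum_congr rfl fun v _ => hfib v]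
  rw [← sum_filter_add_sum_filter_not (univ.filter fun v : Fin N → Bool => HardCore v) (fun v => 0 < zeros v)]
  congr 1
  · rw [Finset.filter_filter]
    refine sum_congr rfl fun v hv => ?_
    obtain ⟨hHC, hz⟩ := (mem_filter.mp hv).2
    rw [card_fibre hN v hHC hz]
    push_cast
    rfl
  · have hset : (univ.filter fun v : Fin N → Bool => HardCore v).filter (fun v => ¬ 0 < zeros v) = {fun _ => true} := by
      ext v
      simp only [Finset.filter_filter, mem_filter, mem_univ, true_and, mem_singleton, not_lt, Nat.le_zero]
      constructor
      · rintro ⟨-, hz⟩; exact eq_allOnes_of_zeros_eq_zero v hz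
      · rintro rfl; exact ⟨hardCore_allOnes (by omega), zeros_allOnes⟩
    rw [hset, sum_singleton, card_fibre_allOnes hN]
    split_ifs <;> simp

/-! ## 2. The fugacity-2 signed `pairs2` sum is `HardCorePairs2.cycSum` -/

/-- `nxt (nxt i) = i + 2 (mod N)`. -/
theorem nxt_nxt_val (i : Fin N) : (nxt (nxt i)).val = (i.val + 2) % N := by
  show ((i.val + 1) % N + 1) % N = _
  rw [Nat.mod_add_mod]

/-- The local sign of the ordered pair `(i, i+2)`. -/
def sg (v : Fin N → Bool) (i : Fin N) : ℝ := if (v i = false ∧ v (nxt (nxt i)) = false) then -1 else 1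

/-- `Π_i sg v i = (−1)^{pairs2 v}`. -/
theorem prod_sg (v : Fin N → Bool) : ∏ i : Fin N, sg v i = (-1 : ℝ) ^ pairs2 v := by
  have hfac : ∀ i : Fin N, sg v i = (-1 : ℝ) ^ (if (v i = false ∧ v (nxt (nxt i)) = false) then 1 else 0) := by
    intro i; unfold sg; split_ifs <;> simp
  rw [Finset.prod_congr rfl fun i _ => hfac i, Finset.prod_pow_eq_pow_sum]
  unfold pairs2
  rw [Finset.card_filter]

/-- `Π_i zf v i = 2^{Z(v)}`. -/
theorem prod_zf (v : Fin N → Bool) : ∏ i : Fin N, HardCorePairs2.zf v i = (2 : ℝ) ^ zeros v := by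
  have hfac : ∀ i : Fin N, HardCorePairs2.zf v i = (2 : ℝ) ^ (if v i = false then 1 else 0) := by
    intro i; unfold HardCorePairs2.zf; split_ifs <;> simp
  rw [Finset.prod_congr rfl fun i _ => hfac i, Finset.prod_pow_eq_pow_sum]
  unfold zeros
  rw [Finset.card_filter]

/-- The linear pair factors together with the two wrap-around factors are the `j+2` cyclic signs `sg`. -/
theorem prod_pf_mul_wrap {j : ℕ} (v : Fin (j + 2) → Bool) :
    (∏ i : Fin (j + 2), HardCorePairs2.pf v i) * (if (v ⟨j, by omega⟩ = false ∧ v 0 = false) then -1 else 1) *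
        (if (v (Fin.last (j + 1)) = false ∧ v ⟨1, by omega⟩ = false) then -1 else 1)
      = ∏ i : Fin (j + 2), sg v i := by
  -- peel the first two (trivial) pair factors and the last two signs
  rw [Fin.prod_univ_succ, Fin.prod_univ_succ]
  conv_rhs => rw [Fin.prod_univ_castSucc, Fin.prod_univ_castSucc]
  have h0 : HardCorePairs2.pf v 0 = 1 := by
    unfold HardCorePairs2.pf; rw [dif_neg (by simp)]
  have h1 : HardCorePairs2.pf v (Fin.succ 0) = 1 := by
    unfold HardCorePairs2.pf; rw [dif_neg (by simp)]
  have hmid : ∀ k : Fin j, HardCorePairs2.pf v (Fin.succ (Fin.succ k)) = sg v (Fin.castSucc (Fin.castSucc k)) := by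
    intro k
    have e1 : (⟨(Fin.succ (Fin.succ k)).val - 2, by simp; omega⟩ : Fin (j + 2)) = Fin.castSucc (Fin.castSucc k) :=
      Fin.ext (by simp)
    have e2 : nxt (nxt (Fin.castSucc (Fin.castSucc k))) = Fin.succ (Fin.succ k) := by
      apply Fin.ext; rw [nxt_nxt_val]; simp [Nat.mod_eq_of_lt (show k.val + 2 < j + 2 by omega)]
    unfold HardCorePairs2.pf sg
    rw [dif_pos (by simp), e1, e2]
  have hw1 : (if (v ⟨j, by omega⟩ = false ∧ v 0 = false) then (-1 : ℝ) else 1) = sg v (Fin.castSucc (Fin.last j)) := by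
    have e1 : (⟨j, by omega⟩ : Fin (j + 2)) = Fin.castSucc (Fin.last j) := Fin.ext (by simp)
    have e2 : nxt (nxt (Fin.castSucc (Fin.last j))) = 0 := by
      apply Fin.ext; rw [nxt_nxt_val]; simp
    unfold sg; rw [e2, e1]
  have hw2 : (if (v (Fin.last (j + 1)) = false ∧ v ⟨1, by omega⟩ = false) then (-1 : ℝ) else 1) = sg v (Fin.last (j + 1)) := by
    have e2 : nxt (nxt (Fin.last (j + 1))) = ⟨1, by omega⟩ := by
      apply Fin.ext; rw [nxt_nxt_val]
      simp only [Fin.val_last]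
      rw [show j + 1 + 2 = (j + 2) + 1 by ring, Nat.add_mod_left]
      exact Nat.mod_eq_of_lt (by omega)
    unfold sg; rw [e2]
  rw [h0, h1, one_mul, one_mul, Finset.prod_congr rfl fun k _ => hmid k, hw1, hw2]

/-- **`cycWt` is the fugacity-2 weight times the `pairs2` sign**: `cycWt v = 2^{Z(v)} · (−1)^{pairs2 v}`. -/
theorem cycWt_eq {j : ℕ} (v : Fin (j + 2) → Bool) :
    HardCorePairs2.cycWt v = (2 : ℝ) ^ zeros v * (-1) ^ pairs2 v := by
  unfold HardCorePairs2.cycWt HardCorePairs2.wt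
  rw [Finset.prod_mul_distrib, prod_zf, ← prod_sg, ← prod_pf_mul_wrap]
  ring

/-- `CycOK` (no two consecutive zeros, ends not both zero) is `Fib19.HardCore` (no two cyclically adjacent zeros). -/
theorem cycOK_iff_hardCore {j : ℕ} (v : Fin (j + 2) → Bool) : HardCorePairs2.CycOK v ↔ HardCore v := by
  constructor
  · rintro ⟨hna, hwrap⟩
    refine ⟨fun i hbad => ?_, ?_⟩
    · by_cases hi : i.val + 1 < j + 2
      · have e : nxt i = ⟨i.val + 1, hi⟩ := Fin.ext (by show (i.val + 1) % (j + 2) = _; exact Nat.mod_eq_of_lt hi)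
        rw [e] at hbad
        exact hna i hi hbad
      · have hiv : i = Fin.last (j + 1) := Fin.ext (by simp; omega)
        have e : nxt i = 0 := Fin.ext (by rw [hiv]; show (j + 1 + 1) % (j + 2) = 0; simp)
        rw [e, hiv] at hbad
        exact hwrap hbad
    · by_cases h0 : v 0 = true
      · exact ⟨0, h0⟩
      · refine ⟨⟨1, by omega⟩, ?_⟩
        have h := hna 0 (by simp)
        have h0' : v 0 = false := by simpa using h0
        by_contra h1
        exact h ⟨h0', by simpa using h1⟩
  · rintro ⟨hHC, -⟩
    refine ⟨fun i hi hbad => ?_, fun hbad => ?_⟩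
    · have e : nxt i = ⟨i.val + 1, hi⟩ := Fin.ext (by show (i.val + 1) % (j + 2) = _; exact Nat.mod_eq_of_lt hi)
      exact hHC i (by rw [e]; exact hbad)
    · have e : nxt (Fin.last (j + 1)) = 0 := Fin.ext (by show (j + 1 + 1) % (j + 2) = 0; simp)
      exact hHC (Fin.last (j + 1)) (by rw [e]; exact hbad)

open scoped Classical in
/-- **The hard-core signed `pairs2` sum is the Literature's `cycSum`.** -/
theorem hardCoreSum_eq_cycSum (j : ℕ) :
    ∑ v ∈ (univ.filter fun v : Fin (j + 2) → Bool => HardCore v), (2 : ℝ) ^ zeros v * (-1) ^ pairs2 v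
      = HardCorePairs2.cycSum j := by
  unfold HardCorePairs2.cycSum
  rw [← Finset.sum_filter]
  have hset : (univ.filter fun v : Fin (j + 2) → Bool => HardCore v) = univ.filter fun v => HardCorePairs2.CycOK v := by
    ext v; simp only [mem_filter, mem_univ, true_and, cycOK_iff_hardCore]
  rw [hset]
  exact sum_congr rfl fun v _ => (cycWt_eq v).symm

/-! ## 3. The parity of `pairs2 (J x)` is unbiased -/

open scoped Classical in
/-- Splitting the hard-core sum off the all-ones word: `cycSum j = 2·Σ_{Z ≥ 1} 2^{Z−1}(−1)^{pairs2} + 1`. -/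
theorem cycSum_eq_two_mul_add_one (j : ℕ) :
    HardCorePairs2.cycSum j
      = 2 * ∑ v ∈ (univ.filter fun v : Fin (j + 2) → Bool => HardCore v ∧ 0 < zeros v),
          (2 : ℝ) ^ (zeros v - 1) * (-1) ^ pairs2 v + 1 := by
  rw [← hardCoreSum_eq_cycSum,
    ← sum_filter_add_sum_filter_not (univ.filter fun v : Fin (j + 2) → Bool => HardCore v) (fun v => 0 < zeros v),
    Finset.filter_filter, Finset.mul_sum]
  congr 1
  · refine sum_congr rfl fun v hv => ?_
    obtain ⟨-, hz⟩ := (mem_filter.mp hv).2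
    obtain ⟨m, hm⟩ : ∃ m, zeros v = m + 1 := ⟨zeros v - 1, by omega⟩
    rw [hm, Nat.add_sub_cancel, pow_succ]
    ring
  · have hset : (univ.filter fun v : Fin (j + 2) → Bool => HardCore v).filter (fun v => ¬ 0 < zeros v) = {fun _ => true} := by
      ext v
      simp only [Finset.filter_filter, mem_filter, mem_univ, true_and, mem_singleton, not_lt, Nat.le_zero]
      constructor
      · rintro ⟨-, hz⟩; exact eq_allOnes_of_zeros_eq_zero v hz
      · rintro rfl; exact ⟨hardCore_allOnes (by omega), zeros_allOnes⟩
    have hp : pairs2 (fun _ : Fin (j + 2) => true) = 0 := by simp [pairs2]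
    rw [hset, sum_singleton, zeros_allOnes, hp]
    simp

/-- The signed count of odd inputs by the parity of `pairs2 (J x)`. -/
theorem two_mul_signSum_eq (j : ℕ) (hj : 1 ≤ j) :
    2 * ∑ x ∈ (univ.filter fun x : Fin (j + 2) → Bool => IsOdd x), (-1 : ℝ) ^ pairs2 (kline x)
      = HardCorePairs2.cycSum j - 1 + 2 * (if (j + 2) % 2 = 1 then 1 else 0) := by
  rw [sum_odd_kline_eq (by omega) (fun v => (-1 : ℝ) ^ pairs2 v), cycSum_eq_two_mul_add_one]
  have hp : pairs2 (fun _ : Fin (j + 2) => true) = 0 := by simp [pairs2]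
  rw [hp]
  split_ifs <;> ring

/-- Signed sum = (#even) − (#odd) and (#even) + (#odd) = `2^{j+1}`: `2·#{x odd : pairs2 (J x) even} − 2^{j+1} = Σ_{x odd} (−1)^{pairs2}`. -/
theorem two_mul_card_even_sub (j : ℕ) :
    2 * ((univ.filter fun x : Fin (j + 2) → Bool => IsOdd x ∧ pairs2 (kline x) % 2 = 0).card : ℝ) - 2 ^ (j + 1)
      = ∑ x ∈ (univ.filter fun x : Fin (j + 2) → Bool => IsOdd x), (-1 : ℝ) ^ pairs2 (kline x) := by
  set A := (univ.filter fun x : Fin (j + 2) → Bool => IsOdd x) with hA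
  have hcard : (A.card : ℝ) = 2 ^ (j + 1) := by
    rw [hA, card_isOdd (by omega)]; push_cast; simp
  have hsplit := Finset.card_filter_add_card_filter_not (s := A) (p := fun x : Fin (j + 2) → Bool => pairs2 (kline x) % 2 = 0)
  have hE : (univ.filter fun x : Fin (j + 2) → Bool => IsOdd x ∧ pairs2 (kline x) % 2 = 0) =
      A.filter (fun x => pairs2 (kline x) % 2 = 0) := by
    rw [hA, Finset.filter_filter]
  rw [hE, ← sum_filter_add_sum_filter_not A (fun x => pairs2 (kline x) % 2 = 0)]
  have h1 : ∑ x ∈ A.filter (fun x => pairs2 (kline x) % 2 = 0), (-1 : ℝ) ^ pairs2 (kline x)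
      = ((A.filter fun x => pairs2 (kline x) % 2 = 0).card : ℝ) := by
    rw [Finset.cast_card, sum_congr rfl fun x hx => ?_]
    have he : Even (pairs2 (kline x)) := Nat.even_iff.2 (mem_filter.mp hx).2
    simp [he.neg_one_pow]
  have h2 : ∑ x ∈ A.filter (fun x => ¬ pairs2 (kline x) % 2 = 0), (-1 : ℝ) ^ pairs2 (kline x)
      = - ((A.filter fun x => ¬ pairs2 (kline x) % 2 = 0).card : ℝ) := by
    rw [Finset.cast_card, ← sum_neg_distrib, sum_congr rfl fun x hx => ?_]
    have ho : Odd (pairs2 (kline x)) := Nat.odd_iff.2 (by have h := (mem_filter.mp hx).2; omega)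
    simp [ho.neg_one_pow]
  rw [h1, h2]
  have hs : ((A.filter fun x => pairs2 (kline x) % 2 = 0).card : ℝ) + ((A.filter fun x => ¬ pairs2 (kline x) % 2 = 0).card : ℝ)
      = 2 ^ (j + 1) := by
    rw [← hcard]; exact_mod_cast hsplit
  linarith

/-- **PAIRS2 PARITY IS UNBIASED (S2).**  On `N = j + 2` positions,
`|#{x odd : pairs2 (J x) even} − 2^j| ≤ (1024·(7/4)^j + 3)/4`; the odd class has `2^{j+1}` elements, so the parity of
`pairs2 (J x)` has bias `≤ 2^7 (7/8)^j + 2^{−j}`. -/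
theorem abs_card_pairs2_even_sub_le (j : ℕ) (hj : 1 ≤ j) :
    |((univ.filter fun x : Fin (j + 2) → Bool => IsOdd x ∧ pairs2 (kline x) % 2 = 0).card : ℝ) - 2 ^ j|
      ≤ (1024 * (7 / 4 : ℝ) ^ j + 3) / 4 := by
  have h1 := two_mul_card_even_sub j
  have h2 := two_mul_signSum_eq j hj
  have h3 := HardCorePairs2.abs_cycSum_le' j
  rw [abs_le] at h3 ⊢
  obtain ⟨h3a, h3b⟩ := h3
  have hpow : (2 : ℝ) ^ (j + 1) = 2 * 2 ^ j := by ring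
  constructor <;> split_ifs at h2 <;> nlinarith

/-- **Corollary for class-pure strategies** (with `rel_iff_pairs2_even`): if at every odd `x` the strategy's win is decided by
`pairs2 (J x) % 2 = 0`, its number of wins among the `2^{j+1}` odd inputs is `2^j ± (2^8 (7/4)^j + 1)`. -/
theorem classPure_wins_half (j : ℕ) (hj : 1 ≤ j) (W : (Fin (j + 2) → Bool) → Prop) [DecidablePred W]
    (hW : ∀ x : Fin (j + 2) → Bool, IsOdd x → (W x ↔ pairs2 (kline x) % 2 = 0)) :
    |((univ.filter fun x : Fin (j + 2) → Bool => IsOdd x ∧ W x).card : ℝ) - 2 ^ j|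
      ≤ (1024 * (7 / 4 : ℝ) ^ j + 3) / 4 := by
  have hset : (univ.filter fun x : Fin (j + 2) → Bool => IsOdd x ∧ W x) =
      univ.filter fun x : Fin (j + 2) → Bool => IsOdd x ∧ pairs2 (kline x) % 2 = 0 := by
    ext x
    simp only [mem_filter, mem_univ, true_and]
    exact ⟨fun h => ⟨h.1, (hW x h.1).1 h.2⟩, fun h => ⟨h.1, (hW x h.1).2 h.2⟩⟩
  rw [hset]
  exact abs_card_pairs2_even_sub_le j hj

end AffBells29lit

end Summit.QuantumAdvantage.AdviceFreeQNC0
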